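import Summits.CriticalPhenomena.PercolationContinuityZ3.Theorems.Transplant.SkelChainUP
import Summits.CriticalPhenomena.PercolationContinuityZ3.Theorems.Transplant.SkelTubeLevels
import Summits.CriticalPhenomena.PercolationContinuityZ3.Theorems.Transplant.BoxProdZ2ConcParams
import HarnessLib

/-!
# L7.1c — the INNER-ROUTE ACCURACY of the generic `concChoice` (fixed before `p`: a function of the skeleton's degree bound only):
# `SkelConc.δUP Φ n ε` (the chain accuracy of `Φ.chain_edge_UP` for chains of `n + 1` steps delivering `1 - ε`, every `q < 1`, every
# subgraph `G' ≤ G` — in particular every window graph `Skel.winGraph G c Rπ`), and `SkelConc.δA Φ K₀ δ₂ := min_{n ≤ nmaxA K} δUP Φ n (δ₂²)`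
# — generic twin of `BoxProdZ2ConcParams` §0 (`δUP X hΔ n ε`, `δA X κ hΔ`; p226064)

builds on p205010 (kernel theorem, internal audit signed; external expert review pending) — nothing in this file uses p205010.
Status sentence (coordinator 2026-08-20T04:30Z): "θ(p_c) = 0 on ℤ^d, all d ≥ 2 — kernel-verified (Lean 4/Mathlib, standard axioms); internal adversarial
audit SIGNED 2026-08-20 04:29Z; external expert review pending."
Lane `prim-bschramm-*`, seat `prim-bschramm-stmt` (gen 7); helper file (`--supports stmt-CriticalPhenomena-4575`).
Parameter ledger: `run/shared/lean/prim/bschramm/prim-bschramm-stmt/CONC-PARAMS-GENERIC.md` §1 rows δA/δUP/nmaxA, §5 (D1): no `hΔ` argument —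
the degree parameter is `Φ.Δ`; `nmaxA K = 1000 K` and `Kof K₀ = max 20 K₀` are the product's (imported).
* `SkelConc.δUP Φ n ε`, `δUP_pos`, `δUP_le_one`, **`δUP_spec`** (every `q < 1`, every `G' ≤ G`), `δUP_spec_win` (every window graph);
* `SkelConc.δA Φ K₀ δ₂`, `δA_le_δUP` (`n ≤ nmaxA (Kof K₀)`), `δA_pos`, `δA_le_one`.
[cite: KozmaNitzan2024, §4 Lemma 12 (pp. 23–25); Theorem 6 (pp. 25–31): the order of constants]
-/

noncomputable section

open MeasureTheory ProbabilityTheory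
open scoped Classical

namespace Summit.CriticalPhenomena.PercolationContinuityZ3.Theorems

namespace Transplant

namespace SkelConc

open Literature.Probability.Percolation Literature.Probability.LatticeModels SimpleGraph KNLevels
open BoxProdZ2 (nmaxA Kof)

variable {V : Type} [DecidableEq V] [Countable V] {G : SimpleGraph V} [G.LocallyFinite] (Φ : PlanarSkeletonConc G)

/-! ## §1 The chain accuracy of `Φ.chain_edge_UP` as a function -/

/-- **The chain accuracy of `Φ.chain_edge_UP`** for chains of `n + 1` steps delivering `1 - ε` (`1` off `0 < ε`). [this work] -/
def δUP (n : ℕ) (ε : ℝ) : ℝ :=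
  if hε : 0 < ε then Classical.choose (Φ.chain_edge_UP n hε) else 1

/-- `0 < δUP`. [folklore] -/
theorem δUP_pos (n : ℕ) (ε : ℝ) : 0 < δUP Φ n ε := by
  unfold δUP; split_ifs with hε
  · exact (Classical.choose_spec (Φ.chain_edge_UP n hε)).1
  · exact one_pos

/-- `δUP ≤ 1`. [folklore] -/
theorem δUP_le_one (n : ℕ) (ε : ℝ) : δUP Φ n ε ≤ 1 := by
  unfold δUP; split_ifs with hε
  · exact (Classical.choose_spec (Φ.chain_edge_UP n hε)).2.1
  · exact le_rfl

/-- **Specification of `δUP`**: the conclusion of `Φ.chain_edge_UP n hε` (every `q < 1`, every subgraph `G' ≤ G`, every weighting) at the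
accuracy `δUP Φ n ε`. [cite: KozmaNitzan2024, §4 Lemma 12 (pp. 23–25)] -/
theorem δUP_spec (n : ℕ) {ε : ℝ} (hε : 0 < ε) :
    ∀ (q : unitInterval), (q : ℝ) < 1 → ∀ (G' : SimpleGraph V) [G'.LocallyFinite], G' ≤ G →
      ∀ (Wt : Sym2 V → unitInterval) (s : Fin (n + 1) → TStep G') (T' : Fin (n + 1) → Finset V) (η : ℝ),
      (∀ i : Fin (n + 1), (s i).L.o = (s 0).L.o) →
      (∀ i : Fin n, T' (Fin.castSucc i) ⊆ (s i.succ).L.X 0) →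
      (∀ i : Fin (n + 1), T' i ⊆ (s i).T) →
      (∀ i : Fin (n + 1), (s i).KitsAt Wt q Φ.Δ (δUP Φ n ε)) →
      η ≤ δUP Φ n ε / 2 →
      (∀ i : Fin (n + 1), (prodBernoulli Wt).real (⋃ t ∈ (s i).T \ T' i, openConn (s 0).L.o t) ≤ η) →
      1 - δUP Φ n ε < (prodBernoulli Wt).real (s 0).L.reachB →
        1 - ε < (prodBernoulli Wt).real (⋃ t ∈ T' (Fin.last n), openConn (s 0).L.o t) := by
  have e : δUP Φ n ε = Classical.choose (Φ.chain_edge_UP n hε) := by unfold δUP; rw [dif_pos hε]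
  rw [e]
  exact (Classical.choose_spec (Φ.chain_edge_UP n hε)).2.2

/-- **`δUP_spec` for the window graphs `Skel.winGraph G c Rπ`** (the `hchain` shape of `Skel.hreach_of_winChain` / `WinAdvData.lt_real_of_advRChain`
/ `Skel.kitAtRun_of_oblR`). [cite: KozmaNitzan2024, §4 Lemma 12 (pp. 23–25)] -/
theorem δUP_spec_win (n : ℕ) {ε : ℝ} (hε : 0 < ε) {q : unitInterval} (hq1 : (q : ℝ) < 1) (c : V) (Rπ : ℕ) :
    ∀ (Wt : Sym2 V → unitInterval) (s : Fin (n + 1) → TStep (Skel.winGraph G c Rπ)) (T' : Fin (n + 1) → Finset V) (η : ℝ),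
      (∀ i : Fin (n + 1), (s i).L.o = (s 0).L.o) →
      (∀ i : Fin n, T' (Fin.castSucc i) ⊆ (s i.succ).L.X 0) →
      (∀ i : Fin (n + 1), T' i ⊆ (s i).T) →
      (∀ i : Fin (n + 1), (s i).KitsAt Wt q Φ.Δ (δUP Φ n ε)) →
      η ≤ δUP Φ n ε / 2 →
      (∀ i : Fin (n + 1), (prodBernoulli Wt).real (⋃ t ∈ (s i).T \ T' i, openConn (s 0).L.o t) ≤ η) →
      1 - δUP Φ n ε < (prodBernoulli Wt).real (s 0).L.reachB →
        1 - ε < (prodBernoulli Wt).real (⋃ t ∈ T' (Fin.last n), openConn (s 0).L.o t) :=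
  δUP_spec Φ n hε q hq1 (Skel.winGraph G c Rπ) (Skel.winGraph_le G c Rπ)

/-! ## §2 The inner-route accuracy -/

/-- **The inner-route accuracy** `δA := min_{n ≤ nmaxA K} δUP Φ n (δ₂²)` (`K = max 20 K₀`; `nmaxA K = 1000 K` bounds every inner chain length of
the face step): one accuracy below the chain accuracy of every inner chain length, fixed before `p`. [this work] -/
def δA (K₀ : ℕ) (δ₂ : ℝ) : ℝ :=
  ((Finset.range (nmaxA (Kof K₀) + 1)).image fun n => δUP Φ n (δ₂ ^ 2)).min'
    ⟨δUP Φ 0 (δ₂ ^ 2), Finset.mem_image.2 ⟨0, by simp, rfl⟩⟩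

/-- `δA ≤ δUP n (δ₂²)` for every inner chain length `n ≤ nmaxA K`. [folklore] -/
theorem δA_le_δUP (K₀ : ℕ) (δ₂ : ℝ) {n : ℕ} (hn : n ≤ nmaxA (Kof K₀)) : δA Φ K₀ δ₂ ≤ δUP Φ n (δ₂ ^ 2) :=
  Finset.min'_le _ _ (Finset.mem_image.2 ⟨n, Finset.mem_range.2 (Nat.lt_succ_of_le hn), rfl⟩)

/-- `0 < δA`. [folklore] -/
theorem δA_pos (K₀ : ℕ) (δ₂ : ℝ) : 0 < δA Φ K₀ δ₂ := by
  unfold δA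
  refine (Finset.lt_min'_iff _ _).2 fun y hy => ?_
  obtain ⟨n, -, rfl⟩ := Finset.mem_image.1 hy
  exact δUP_pos Φ n _

/-- `δA ≤ 1`. [folklore] -/
theorem δA_le_one (K₀ : ℕ) (δ₂ : ℝ) : δA Φ K₀ δ₂ ≤ 1 :=
  (δA_le_δUP Φ K₀ δ₂ (Nat.zero_le _)).trans (δUP_le_one Φ 0 _)

/-- `0 < δA²` (the input accuracy `δin := (δmin …)²` is positive as soon as `δA` is). [folklore] -/
theorem δA_sq_pos (K₀ : ℕ) (δ₂ : ℝ) : 0 < δA Φ K₀ δ₂ ^ 2 := pow_pos (δA_pos Φ K₀ δ₂) 2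

end SkelConc

end Transplant

end Summit.CriticalPhenomena.PercolationContinuityZ3.Theorems

end
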